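import Mathlib
import HarnessLib
import Summits.Ventures.LatticeQCDFlow.Exactness.SplittingIntegrator

/-!
# The exact geodesic drift on the sphere's tangent bundle is time-reversible under the momentum flip, so the sphere leapfrog followed by the flip is an involution

HONEST FRAMING: exact (Metropolis-corrected) sampling algorithms for lattice gauge theory;
figures of merit are autocorrelation/cost numbers at stated couplings and volumes; no
continuum-physics claim.

Venture `LatticeQCDFlow` (cell pub-lqcd), topic `Exactness`; FANOUT row 7 (`s0-cpn-null`: the
S0-D1 rung — 2D CP⁹ HMC and THMC, both run with the same molecular dynamics on the site spheres).
NEW WORK of the cell over Mathlib (real inner product spaces) and the tree's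
`Exactness/SplittingIntegrator.lean` (row 9: `IsFlipReversible R Φ : R * Φ * R = Φ⁻¹` in
`Equiv.Perm`, closed under palindromes and powers; `IsFlipReversible.involutive`: `R ∘ Φ` is an
involution — hypothesis 1 of the HMC skeleton `InvolutiveMetropolis.involMH`).  Nothing is cited
as a fact.  Printed counterpart, NAMED ONLY: Engel–Schaefer, Comput. Phys. Commun. 182 (2011)
2107, §2.2 eqs. (9)–(11): HMC for CP(N−1) with momenta `π_n` tangent to the site sphere,
leapfrog with the EXACT geodesic position update
`x(τ) = cos(|π|τ) x + sin(|π|τ) π/|π|`, `π(τ) = −|π| sin(|π|τ) x + cos(|π|τ) π`.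

`SplittingIntegrator.lean` discharges reversibility for drifts of the form `(q, p) ↦ (d_p q, p)`
(flat and Lie-group drifts).  The sphere drift is not of that form — the momentum rotates with the
position — so this file does the sphere case by hand, on the tangent bundle
`TS = {(x, π) : ‖x‖ = 1, ⟪x, π⟫ = 0}` of the unit sphere of a real inner product space `V`
(`V = ℝ^{2N}` per site for CP(N−1)).

## Content

* `geodesicDrift τ (x, π)` — eq. (11) (`= (x, π)` when `π = 0`); `norm_fst_geodesicDrift` (stays on
  the sphere), `inner_geodesicDrift` (momentum stays tangent), **`norm_snd_geodesicDrift`**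
  (`‖π‖`, i.e. the kinetic energy, is conserved exactly — free geodesic motion),
  `geodesicDrift_zero`.
* **`geodesicDrift_flip_geodesicDrift`** — TIME REVERSAL: drifting, flipping the momentum and
  drifting again returns to the flipped start, `Φ_τ (x', −π') = (x, −π)`.
* On the tangent bundle as permutations: `TangentSphere V`, `flipTS` (an involution,
  `flipTS_mul_flipTS`), `driftTS τ` (inverse `flipTS ∘ driftTS τ ∘ flipTS`), `kickTS F δ` for a
  TANGENT force field `F` (`⟪x, F x⟫ = 0`: the projected force of eq. (10)), and
  **`driftTS_isFlipReversible`**, **`kickTS_isFlipReversible`**,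
  **`leapfrogTS_isFlipReversible`** (kick–drift–kick, any step sizes, any tangent force — exact or
  not), `leapfrogTS_pow_isFlipReversible` (a trajectory), **`involutive_flip_leapfrogTS_pow`**:
  the CP(N−1) HMC/THMC proposal "trajectory then momentum flip" is an INVOLUTION of `TS`.

NOT CLAIMED: preservation of the Liouville measure of `TS` by the drift and the kick (hypothesis 2
of `involMH`; for the drift it is the geodesic flow's symplecticity, for the kick a shear along
the fibres — neither is formalised here); the product over sites and the link/momentum factors
(flip-reversibility of a product map is componentwise); anything quantitative.
-/

noncomputable section

namespace Summit.Ventures.LatticeQCDFlow.Exactness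

open Real
open scoped InnerProductSpace

variable {V : Type*} [NormedAddCommGroup V] [InnerProductSpace ℝ V]

/-! ## The drift of E–S eq. (11) -/

/-- **Exact geodesic motion on the unit sphere** for time `τ` from position `x` with tangent
momentum `π` (E–S eq. (11)): `x(τ) = cos(‖π‖τ) x + (sin(‖π‖τ)/‖π‖) π`,
`π(τ) = −‖π‖ sin(‖π‖τ) x + cos(‖π‖τ) π`; for `π = 0` the point rests (`0/0 = 0`). -/
def geodesicDrift (τ : ℝ) (z : V × V) : V × V :=
  (cos (‖z.2‖ * τ) • z.1 + (sin (‖z.2‖ * τ) / ‖z.2‖) • z.2,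
    (-(‖z.2‖ * sin (‖z.2‖ * τ))) • z.1 + cos (‖z.2‖ * τ) • z.2)

/-- The momentum flip `(x, π) ↦ (x, −π)`. -/
def sphereMomFlip (z : V × V) : V × V := (z.1, -z.2)

omit [InnerProductSpace ℝ V] in
/-- The flip is an involution. -/
@[simp] theorem sphereMomFlip_sphereMomFlip (z : V × V) : sphereMomFlip (sphereMomFlip z) = z := by
  simp [sphereMomFlip]

/-- At `τ = 0` nothing moves. -/
theorem geodesicDrift_zero (z : V × V) : geodesicDrift 0 z = z := by
  rcases z with ⟨x, p⟩
  simp [geodesicDrift]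

section OnTS

variable {x p : V} (τ : ℝ)

/-- **The drift stays on the sphere**: `‖x(τ)‖ = 1` for `‖x‖ = 1`, `⟪x, p⟫ = 0`. -/
theorem norm_fst_geodesicDrift (hx : ‖x‖ = 1) (hxp : ⟪x, p⟫_ℝ = 0) :
    ‖(geodesicDrift τ (x, p)).1‖ = 1 := by
  have hsq : ‖(geodesicDrift τ (x, p)).1‖ ^ 2 = 1 := by
    simp only [geodesicDrift]
    rw [norm_add_sq_real, norm_smul, norm_smul, hx, mul_one, real_inner_smul_left,
      real_inner_smul_right, hxp, mul_zero, mul_zero, mul_zero, add_zero, Real.norm_eq_abs,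
      Real.norm_eq_abs, sq_abs, mul_pow, sq_abs, div_pow]
    rcases eq_or_ne (‖p‖) 0 with h | h
    · rw [h]; simp
    · field_simp
      rw [cos_sq_add_sin_sq]
  nlinarith [norm_nonneg (geodesicDrift τ (x, p)).1, hsq]

/-- **The momentum stays tangent**: `⟪x(τ), π(τ)⟫ = 0`. -/
theorem inner_geodesicDrift (hx : ‖x‖ = 1) (hxp : ⟪x, p⟫_ℝ = 0) :
    ⟪(geodesicDrift τ (x, p)).1, (geodesicDrift τ (x, p)).2⟫_ℝ = 0 := by
  simp only [geodesicDrift]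
  rw [inner_add_left, inner_add_right, inner_add_right, real_inner_smul_left, real_inner_smul_left,
    real_inner_smul_left, real_inner_smul_left, real_inner_smul_right, real_inner_smul_right,
    real_inner_smul_right, real_inner_smul_right, real_inner_self_eq_norm_sq,
    real_inner_self_eq_norm_sq, hx, hxp, real_inner_comm x p, hxp]
  rcases eq_or_ne (‖p‖) 0 with h | h
  · rw [h]; simp
  · field_simp
    ring

/-- **Kinetic energy is conserved exactly**: `‖π(τ)‖ = ‖π‖`. -/
theorem norm_snd_geodesicDrift (hx : ‖x‖ = 1) (hxp : ⟪x, p⟫_ℝ = 0) :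
    ‖(geodesicDrift τ (x, p)).2‖ = ‖p‖ := by
  have hsq : ‖(geodesicDrift τ (x, p)).2‖ ^ 2 = ‖p‖ ^ 2 := by
    simp only [geodesicDrift]
    rw [norm_add_sq_real, norm_smul, norm_smul, hx, mul_one, real_inner_smul_left,
      real_inner_smul_right, hxp, mul_zero, mul_zero, mul_zero, add_zero, Real.norm_eq_abs,
      Real.norm_eq_abs, sq_abs, mul_pow, sq_abs]
    nlinarith [cos_sq_add_sin_sq (‖p‖ * τ), sq_nonneg ‖p‖]
  have h0 : 0 ≤ ‖(geodesicDrift τ (x, p)).2‖ := norm_nonneg _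
  have h1 : 0 ≤ ‖p‖ := norm_nonneg _
  nlinarith [hsq, h0, h1]

/-- **Time reversal.**  Drift, flip the momentum, drift again: you are back at the flipped start,
`geodesicDrift τ (sphereMomFlip (geodesicDrift τ (x, p))) = sphereMomFlip (x, p)` (`‖x‖ = 1`, `⟪x, p⟫ = 0`). -/
theorem geodesicDrift_flip_geodesicDrift (hx : ‖x‖ = 1) (hxp : ⟪x, p⟫_ℝ = 0) :
    geodesicDrift τ (sphereMomFlip (geodesicDrift τ (x, p))) = sphereMomFlip (x, p) := by
  have hn : ‖-(geodesicDrift τ (x, p)).2‖ = ‖p‖ := by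
    rw [norm_neg, norm_snd_geodesicDrift τ hx hxp]
  rcases eq_or_ne (‖p‖) 0 with h0 | h0
  · -- no momentum: nothing moves
    have hp : p = 0 := norm_eq_zero.1 h0
    subst hp
    simp [geodesicDrift, sphereMomFlip]
  · -- `ω = ‖p‖ ≠ 0`; the flipped momentum has norm `ω` again, so the second drift uses the same
    -- `c = cos(ωτ)`, `s = sin(ωτ)`
    have hn' : ‖-((-(‖p‖ * sin (‖p‖ * τ))) • x + cos (‖p‖ * τ) • p)‖ = ‖p‖ := hn
    show geodesicDrift τ (cos (‖p‖ * τ) • x + (sin (‖p‖ * τ) / ‖p‖) • p,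
        -((-(‖p‖ * sin (‖p‖ * τ))) • x + cos (‖p‖ * τ) • p)) = (x, -p)
    unfold geodesicDrift
    simp only [hn']
    set c := cos (‖p‖ * τ) with hc
    set s := sin (‖p‖ * τ) with hs
    set ω := ‖p‖ with hω
    have hcs : c ^ 2 + s ^ 2 = 1 := cos_sq_add_sin_sq _
    have hss : s / ω * (ω * s) = s * s := by
      rw [div_mul_eq_mul_div, mul_comm ω s, ← mul_assoc, mul_div_assoc, div_self h0, mul_one]
    refine Prod.ext ?_ ?_
    · show c • (c • x + (s / ω) • p) + (s / ω) • -((-(ω * s)) • x + c • p) = x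
      have key : c • (c • x + (s / ω) • p) + (s / ω) • -((-(ω * s)) • x + c • p)
          = (c * c + s / ω * (ω * s)) • x + (c * (s / ω) - s / ω * c) • p := by
        module
      rw [key, hss, show c * c + s * s = 1 by linear_combination hcs,
        show c * (s / ω) - s / ω * c = 0 by ring, one_smul, zero_smul, add_zero]
    · show (-(ω * s)) • (c • x + (s / ω) • p) + c • -((-(ω * s)) • x + c • p) = -p
      have key : (-(ω * s)) • (c • x + (s / ω) • p) + c • -((-(ω * s)) • x + c • p)
          = (-(ω * s) * c + c * (ω * s)) • x + (-(s / ω * (ω * s)) - c * c) • p := by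
        module
      rw [key, hss, show -(ω * s) * c + c * (ω * s) = 0 by ring,
        show -(s * s) - c * c = -1 by linear_combination (-1 : ℝ) * hcs, zero_smul, zero_add,
        neg_one_smul]

end OnTS

/-! ## The tangent bundle of the sphere and the leapfrog pieces as permutations of it -/

/-- The TANGENT BUNDLE of the unit sphere: positions of norm one with orthogonal momenta — the
phase space of one CP(N−1) site (`V = ℝ^{2N}`). -/
def TangentSphere (V : Type*) [NormedAddCommGroup V] [InnerProductSpace ℝ V] : Type _ :=
  {z : V × V // ‖z.1‖ = 1 ∧ ⟪z.1, z.2⟫_ℝ = 0}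

namespace TangentSphere

/-- The momentum flip as a permutation of the tangent bundle. -/
def flipTS : Equiv.Perm (TangentSphere V) where
  toFun z := ⟨sphereMomFlip z.1, by
    refine ⟨z.2.1, ?_⟩
    simp only [sphereMomFlip, inner_neg_right, z.2.2, neg_zero]⟩
  invFun z := ⟨sphereMomFlip z.1, by
    refine ⟨z.2.1, ?_⟩
    simp only [sphereMomFlip, inner_neg_right, z.2.2, neg_zero]⟩
  left_inv z := Subtype.ext (sphereMomFlip_sphereMomFlip z.1)
  right_inv z := Subtype.ext (sphereMomFlip_sphereMomFlip z.1)

/-- The underlying map of the flip. -/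
@[simp] theorem coe_flipTS (z : TangentSphere V) : (flipTS z).1 = sphereMomFlip z.1 := rfl

/-- The flip is an involution: `flipTS * flipTS = 1`. -/
theorem flipTS_mul_flipTS : (flipTS : Equiv.Perm (TangentSphere V)) * flipTS = 1 := by
  ext z : 1
  exact Subtype.ext (sphereMomFlip_sphereMomFlip z.1)

/-- A point of the tangent bundle stays in it under the drift. -/
theorem geodesicDrift_mem (τ : ℝ) (z : TangentSphere V) :
    ‖(geodesicDrift τ z.1).1‖ = 1 ∧ ⟪(geodesicDrift τ z.1).1, (geodesicDrift τ z.1).2⟫_ℝ = 0 := by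
  obtain ⟨⟨x, p⟩, hx, hxp⟩ := z
  exact ⟨norm_fst_geodesicDrift τ hx hxp, inner_geodesicDrift τ hx hxp⟩

/-- **The geodesic drift as a permutation of the tangent bundle**; its inverse is
"flip, drift, flip" (time reversal). -/
def driftTS (τ : ℝ) : Equiv.Perm (TangentSphere V) where
  toFun z := ⟨geodesicDrift τ z.1, geodesicDrift_mem τ z⟩
  invFun z := flipTS ⟨geodesicDrift τ (flipTS z).1, geodesicDrift_mem τ (flipTS z)⟩
  left_inv z := by
    obtain ⟨⟨x, p⟩, hx, hxp⟩ := z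
    apply Subtype.ext
    simp only [coe_flipTS]
    rw [geodesicDrift_flip_geodesicDrift τ hx hxp, sphereMomFlip_sphereMomFlip]
  right_inv z := by
    obtain ⟨⟨x, p⟩, hx, hxp⟩ := z
    apply Subtype.ext
    simp only [coe_flipTS]
    have hxp' : ⟪x, -p⟫_ℝ = 0 := by rw [inner_neg_right, hxp, neg_zero]
    have h := geodesicDrift_flip_geodesicDrift τ hx hxp'
    simp only [sphereMomFlip, neg_neg] at h ⊢
    exact h

/-- The underlying map of the drift. -/
@[simp] theorem coe_driftTS (τ : ℝ) (z : TangentSphere V) : (driftTS τ z).1 = geodesicDrift τ z.1 :=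
  rfl

/-- **The geodesic drift is time-reversible under the momentum flip**:
`flipTS * driftTS τ * flipTS = (driftTS τ)⁻¹`. -/
theorem driftTS_isFlipReversible (τ : ℝ) :
    IsFlipReversible (flipTS : Equiv.Perm (TangentSphere V)) (driftTS τ) := by
  ext z : 1
  rfl

/-- The momentum KICK by a tangent force field `F` (`⟪x, F x⟫ = 0`: the sphere-projected force of
E–S eq. (10), exact or approximate) with step `δ`: `(x, π) ↦ (x, π + δ F x)`, a permutation of the
tangent bundle. -/
def kickTS (F : V → V) (hF : ∀ x, ⟪x, F x⟫_ℝ = 0) (δ : ℝ) : Equiv.Perm (TangentSphere V) where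
  toFun z := ⟨(z.1.1, z.1.2 + δ • F z.1.1), ⟨z.2.1, by
    rw [inner_add_right, real_inner_smul_right, z.2.2, hF, mul_zero, add_zero]⟩⟩
  invFun z := ⟨(z.1.1, z.1.2 - δ • F z.1.1), ⟨z.2.1, by
    rw [inner_sub_right, real_inner_smul_right, z.2.2, hF, mul_zero, sub_zero]⟩⟩
  left_inv z := by
    apply Subtype.ext
    simp
  right_inv z := by
    apply Subtype.ext
    simp

/-- **The kick is time-reversible under the flip** (no hypothesis on the force beyond tangency). -/
theorem kickTS_isFlipReversible (F : V → V) (hF : ∀ x, ⟪x, F x⟫_ℝ = 0) (δ : ℝ) :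
    IsFlipReversible (flipTS : Equiv.Perm (TangentSphere V)) (kickTS F hF δ) := by
  ext z : 1
  apply Subtype.ext
  simp only [Equiv.Perm.coe_mul, Function.comp_apply, coe_flipTS, sphereMomFlip, kickTS, Equiv.coe_fn_mk,
    Equiv.Perm.inv_def, Equiv.coe_fn_symm_mk, Prod.mk.injEq, true_and]
  abel

/-- The sphere leapfrog step of E–S §2.2: half kick, exact geodesic drift, half kick. -/
def leapfrogTS (F : V → V) (hF : ∀ x, ⟪x, F x⟫_ℝ = 0) (δ : ℝ) : Equiv.Perm (TangentSphere V) :=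
  kickTS F hF (δ / 2) * driftTS δ * kickTS F hF (δ / 2)

/-- **The sphere leapfrog step is time-reversible** (`IsFlipReversible.palindrome`). -/
theorem leapfrogTS_isFlipReversible (F : V → V) (hF : ∀ x, ⟪x, F x⟫_ℝ = 0) (δ : ℝ) :
    IsFlipReversible (flipTS : Equiv.Perm (TangentSphere V)) (leapfrogTS F hF δ) :=
  (kickTS_isFlipReversible F hF (δ / 2)).palindrome (driftTS_isFlipReversible δ) flipTS_mul_flipTS

/-- … and so is a trajectory of `n` steps. -/
theorem leapfrogTS_pow_isFlipReversible (F : V → V) (hF : ∀ x, ⟪x, F x⟫_ℝ = 0) (δ : ℝ) (n : ℕ) :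
    IsFlipReversible (flipTS : Equiv.Perm (TangentSphere V)) (leapfrogTS F hF δ ^ n) :=
  (leapfrogTS_isFlipReversible F hF δ).pow flipTS_mul_flipTS n

/-- **The HMC/THMC proposal on the site sphere is an involution**: `n` sphere-leapfrog steps
followed by the momentum flip, applied twice, is the identity — hypothesis 1 of the tree's HMC
skeleton `InvolutiveMetropolis.involMH`, for every tangent force, step size and trajectory
length. -/
theorem involutive_flip_leapfrogTS_pow (F : V → V) (hF : ∀ x, ⟪x, F x⟫_ℝ = 0) (δ : ℝ) (n : ℕ) :
    Function.Involutive ⇑((flipTS : Equiv.Perm (TangentSphere V)) * leapfrogTS F hF δ ^ n) :=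
  (leapfrogTS_pow_isFlipReversible F hF δ n).involutive

end TangentSphere

end Summit.Ventures.LatticeQCDFlow.Exactness

end
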